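import Summits.QuantumFields.YangMills.Theorems.ColdStartUniversalityLatticeLangevinMartingaleCLT
import Summits.QuantumFields.YangMills.Theorems.ColdStartUniversalityLatticeLangevinBlockIncrements
import Summits.QuantumFields.YangMills.Theorems.ColdStartUniversalityLatticeLangevinPoissonEquation
import Summits.QuantumFields.YangMills.Theorems.ColdStartUniversalityLatticeLangevinAsymptoticVarianceNonneg
import HarnessLib

/-!
# Route `ColdStartUniversality` (fixed-cut-off SZZ dynamics, sampler package): WEIGHTED BLOCK-MARTINGALE CLT ESTIMATE —
# `‖E exp(iθ T^(−1/2) Σ_k w_k D_k) − e^(−θ² σ² (Σ_k w_k²/J)/2)‖ ≤ Φ_θ(η_b/b, (2β_u+2b)/√T, 1/J)` for block weights `|w_k| ≤ 1`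

Helper file (seat `ym-line-csu-p1`, g35; `--supports stmt-QuantumFields-24809`).  The engine step of the FUNCTIONAL central limit theorem
(finite-dimensional distributions of the partial-sum process, next file): the block increments `D_k` of the Poisson martingale (file 94a; exported
here with the corrector `u`, `|u| ≤ β_u`, and the telescoping identity `Σ_(k<n) D_k = u(U_(nb)) − u(x) + ∫_(0,nb] Ĝ(U_r)dr`) may be WEIGHTED by any
deterministic `w_k ∈ [−1, 1]` — weights preserve orthogonality to the past and scale the predictable variance by `w_k²` — so that for `T = Jb`
(★★ `norm_charFun_weightedBlocks_sub_gaussian_le_of_prog`)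

  `‖E exp(iθ T^(−1/2) Σ_(k<J) w_k D_k) − exp(−θ² s²/2)‖ ≤ e^(θ²σ²/2)(θ²E + |θ|³e^(|θ|B)B(σ² + E) + θ⁴σ⁴/(4J) + (|θ|B + θ²B²/2)θ²σ²/2)`,
  `s² = σ²(G)·(Σ_(k<J) w_k²)/J`,  `E = η_b/b`,  `B = (2β_u + 2b)/√T`,

for every progressively measurable strong solution, every continuous `|G| ≤ 1`, every `b > 0`, `J ≥ 1`, real `θ`.  With window-indicator weights
this gives the joint Gaussian limit of the increments of `s ↦ T^(−1/2)∫₀^(sT) Ĝ(U_r)dr` over disjoint windows (independent `N(0, σ²Δs)`).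
THEOREMS ONLY, no definition, no sorry; [folklore].  HONEST FRAMING: fixed cut-off; `β_u, K` depend on `L, β'`; `UniformColdStartMixing` (24809) is
NOT restated; no crux, rung or summit statement is proved; the Yang–Mills mass gap is NOT proved.
-/

set_option autoImplicit false

noncomputable section

namespace Summit.QuantumFields.YangMills.Theorems.ColdStartUniversality

open MeasureTheory ProbabilityTheory Filter Topology Set
open scoped NNReal ENNReal BigOperators
open Literature Literature.Probability.Process Literature.MathematicalPhysics.QuantumFieldTheory
open Literature.MathematicalPhysics.QuantumLattice (fundamentalRep fundamentalLatticeRep continuous_fundamentalRep)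

variable {L : ℕ} [NeZero L]

/-- ★★ **Weighted block-martingale CLT estimate** (see the module docstring): the corrector `u` and block increments `D_k` (telescoping), and for
all block weights `|w_k| ≤ 1` the Fourier-distance bound to the Gaussian of variance `σ²·Σ_(k<J) w_k²/J`. [folklore] -/
theorem norm_charFun_weightedBlocks_sub_gaussian_le_of_prog (L : ℕ) [NeZero L] (β' : ℝ) :
    ∃ βu K : ℝ, 0 ≤ βu ∧ 0 ≤ K ∧
      ∀ (κ : ℝ≥0 → Kernel (GaugeConfig 3 L (Matrix.specialUnitaryGroup (Fin 2) ℂ))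
          (GaugeConfig 3 L (Matrix.specialUnitaryGroup (Fin 2) ℂ))) [∀ t, IsMarkovKernel (κ t)],
        (∀ (t : ℝ≥0) (x : GaugeConfig 3 L (Matrix.specialUnitaryGroup (Fin 2) ℂ))
          (Ω : Type) [MeasurableSpace Ω] (P : Measure Ω) [IsProbabilityMeasure P]
          (W : ℝ≥0 → Ω → (Edge 3 L × NoiseIdx 2 → ℝ)) (hW : IsFlatBrownian W P)
          (U : ℝ≥0 → Ω → GaugeConfig 3 L (Matrix.specialUnitaryGroup (Fin 2) ℂ)),
          (∀ ω, U 0 ω = x) →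
          (latticeLangevinDynamics (fundamentalLatticeRep 2) β').IsSolution (fundamentalRep (Fin 2))
            hW.natFiltration P W U →
          κ t x = P.map (U t)) →
        ∀ (x : GaugeConfig 3 L (Matrix.specialUnitaryGroup (Fin 2) ℂ))
          (Ω : Type) [MeasurableSpace Ω] (P : Measure Ω) [IsProbabilityMeasure P]
          (W : ℝ≥0 → Ω → (Edge 3 L × NoiseIdx 2 → ℝ)) (hW : IsFlatBrownian W P)
          (U : ℝ≥0 → Ω → GaugeConfig 3 L (Matrix.specialUnitaryGroup (Fin 2) ℂ)),
          (∀ ω, U 0 ω = x) →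
          (latticeLangevinDynamics (fundamentalLatticeRep 2) β').IsSolution (fundamentalRep (Fin 2)) hW.natFiltration P W U →
          (∀ i : ℝ≥0, Measurable[@Prod.instMeasurableSpace (Set.Iic i) Ω inferInstance (hW.natFiltration i)]
            (fun q : Set.Iic i × Ω => U q.1 q.2)) →
        ∀ (G : GaugeConfig 3 L (Matrix.specialUnitaryGroup (Fin 2) ℂ) → ℝ), Continuous G → (∀ z, |G z| ≤ 1) →
        ∀ (σ2 : ℝ), σ2 = 2 * ∫ t in Ioi (0 : ℝ),
            (∫ y, (G y - ∫ z, G z ∂(wilsonMeasure (d := 3) (L := L) (fundamentalRep (Fin 2)) β')) *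
              (∫ z, (G z - ∫ z', G z' ∂(wilsonMeasure (d := 3) (L := L) (fundamentalRep (Fin 2)) β')) ∂(κ t.toNNReal y))
              ∂(wilsonMeasure (d := 3) (L := L) (fundamentalRep (Fin 2)) β')) →
        ∀ (b : ℝ), 0 < b →
        ∃ (u : GaugeConfig 3 L (Matrix.specialUnitaryGroup (Fin 2) ℂ) → ℝ) (D : ℕ → Ω → ℝ),
          (∀ y, |u y| ≤ βu) ∧ (∀ k, Measurable (D k)) ∧
          (∀ (n : ℕ) ω, ∑ k ∈ Finset.range n, D k ω = u (U (((n : ℝ) * b).toNNReal) ω) - u x +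
            ∫ r in Ioc (0 : ℝ) (n * b), (G (U r.toNNReal ω) - ∫ z', G z' ∂(wilsonMeasure (d := 3) (L := L) (fundamentalRep (Fin 2)) β'))) ∧
          0 ≤ σ2 ∧
          ∀ (J : ℕ), 1 ≤ J → ∀ (w : ℕ → ℝ), (∀ k, |w k| ≤ 1) → ∀ (θ : ℝ),
          ‖(∫ ω, Complex.exp (((θ * ((Real.sqrt (J * b))⁻¹ * ∑ k ∈ Finset.range J, w k * D k ω) : ℝ) : ℂ) * Complex.I) ∂P) -
              Complex.exp (-((θ ^ 2 * (σ2 * (∑ k ∈ Finset.range J, w k ^ 2) / J) / 2 : ℝ) : ℂ))‖ ≤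
            Real.exp (θ ^ 2 * σ2 / 2) *
              (θ ^ 2 * ((K + 2 * βu * ((b * σ2 + K) / Real.sqrt (1 + b) + Real.sqrt (1 + b)) + 4 * βu ^ 2) / b) +
                |θ| ^ 3 * Real.exp (|θ| * ((2 * βu + 2 * b) / Real.sqrt (J * b))) * ((2 * βu + 2 * b) / Real.sqrt (J * b)) *
                  (σ2 + (K + 2 * βu * ((b * σ2 + K) / Real.sqrt (1 + b) + Real.sqrt (1 + b)) + 4 * βu ^ 2) / b) +
                θ ^ 4 * σ2 ^ 2 / 4 * (J : ℝ)⁻¹ +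
                (|θ| * ((2 * βu + 2 * b) / Real.sqrt (J * b)) + θ ^ 2 * ((2 * βu + 2 * b) / Real.sqrt (J * b)) ^ 2 / 2) * (θ ^ 2 * σ2 / 2)) := by
  classical
  haveI := secondCountableTopology_su2
  haveI := borelSpace_config L
  obtain ⟨Cu, cu, hCu, hcu, hPoisAll⟩ := exists_poisson_solution L β'
  obtain ⟨K, hK, hblocks⟩ := exists_blockIncrements L β'
  refine ⟨2 * Cu / cu, K, by positivity, hK, fun κ _ hreal x Ω _ P _ W hW U hU0 hU hprog G hGc hG1 σ2 hσ2 b hb => ?_⟩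
  set μ : Measure (GaugeConfig 3 L (Matrix.specialUnitaryGroup (Fin 2) ℂ)) :=
    wilsonMeasure (d := 3) (L := L) (fundamentalRep (Fin 2)) β' with hμ
  haveI : IsProbabilityMeasure μ :=
    isProbabilityMeasure_wilsonMeasure (d := 3) (L := L) (fundamentalRep (Fin 2)) (continuous_fundamentalRep (Fin 2)) β'
  set m : ℝ := ∫ z, G z ∂μ with hm
  have hG : Measurable G := hGc.measurable
  have hm1 : |m| ≤ 1 := by
    have hh := norm_integral_le_of_norm_le_const (μ := μ) (f := G) (C := 1)
      (Eventually.of_forall fun z => by simpa [Real.norm_eq_abs] using hG1 z)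
    simpa [Real.norm_eq_abs] using hh
  set Gh : GaugeConfig 3 L (Matrix.specialUnitaryGroup (Fin 2) ℂ) → ℝ := fun z => G z - m with hGh
  have hGhc : Continuous Gh := hGc.sub continuous_const
  have hGhm : Measurable Gh := hG.sub measurable_const
  have hGhb : ∀ z, |Gh z| ≤ 2 := fun z => by
    show |G z - m| ≤ 2
    have := abs_sub (G z) m
    linarith [hG1 z]
  have hGh0 : ∫ z, Gh z ∂μ = 0 := by
    simp only [hGh]
    rw [integral_sub ((integrable_const (1 : ℝ)).mono' hG.aestronglyMeasurable (Eventually.of_forall fun z => by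
      simpa [Real.norm_eq_abs] using hG1 z)) (integrable_const m), integral_const, smul_eq_mul, probReal_univ, one_mul, hm]
    exact sub_self _
  have hσ0 : 0 ≤ σ2 := by rw [hσ2]; exact mul_nonneg (by norm_num) (greenKubo_nonneg L β' κ hreal hGc hG1)
  set βu : ℝ := 2 * Cu / cu with hβu
  have hβ0 : 0 ≤ βu := by positivity
  have hmU : ∀ s : ℝ≥0, Measurable (U s) := fun s => (hU.adapted s).mono (hW.natFiltration.le s) le_rfl
  /- ### 1. The Poisson corrector and the block increments -/
  obtain ⟨u, huc, -, hub', -, hPois⟩ := hPoisAll κ hreal Gh hGhc hGh0 2 hGhb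
  have hum : Measurable u := huc.measurable
  have hub : ∀ y, |u y| ≤ βu := fun y => (hub' y).trans (le_of_eq hβu.symm)
  obtain ⟨D, hDF, hDb, horth, hvar, htel⟩ := hblocks κ hreal x Ω P W hW U hU0 hU hprog G hGc hG1 u hum βu hub hPois b hb
  have hDm : ∀ k, Measurable (D k) := fun k => (hDF k).mono (hW.natFiltration.le _) le_rfl
  set ηb : ℝ := K + 2 * βu * ((b * σ2 + K) / Real.sqrt (1 + b) + Real.sqrt (1 + b)) + 4 * βu ^ 2 with hηb
  have hηb0 : 0 ≤ ηb := by positivity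
  have hvar' : ∀ (k : ℕ) (Z : Ω → ℝ), Measurable[hW.natFiltration (((k : ℝ) * b).toNNReal)] Z → (∀ ω, 0 ≤ Z ω) →
      (∃ CZ : ℝ, ∀ ω, Z ω ≤ CZ) → |∫ ω, Z ω * (D k ω ^ 2 - b * σ2) ∂P| ≤ ηb * ∫ ω, Z ω ∂P := by
    intro k Z hZ hZ0 hZb
    have h := hvar k Z hZ hZ0 hZb
    rw [← hσ2, abs_of_nonneg hσ0] at h
    exact h
  refine ⟨u, D, hub, hDm, htel, hσ0, fun J hJ w hw θ => ?_⟩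
  set T : ℝ := J * b with hT
  have hJr : (1 : ℝ) ≤ J := by exact_mod_cast hJ
  have hT0 : 0 < T := by positivity
  have hsT : 0 < Real.sqrt T := Real.sqrt_pos.2 hT0
  set t : ℝ := (Real.sqrt T)⁻¹ with ht
  have ht0 : 0 < t := inv_pos.2 hsT
  have ht2 : t ^ 2 = T⁻¹ := by rw [ht, inv_pow, Real.sq_sqrt hT0.le]
  have hw2 : ∀ k, w k ^ 2 ≤ 1 := fun k => by
    have := hw k; rw [← sq_abs]; nlinarith [abs_nonneg (w k)]
  set s2 : ℝ := σ2 * (∑ k ∈ Finset.range J, w k ^ 2) / J with hs2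
  have hs2_0 : 0 ≤ s2 := by positivity
  /- ### 2. The engine with `D'_k = w_k D_k/√T`, `v'_k = w_k² bσ²/T`, `n = J` -/
  set D' : ℕ → Ω → ℝ := fun k ω => t * (w k * D k ω) with hD'
  set v' : ℕ → Ω → ℝ := fun k _ => t ^ 2 * (w k ^ 2 * (b * σ2)) with hv'
  have hD'm : ∀ k, Measurable (D' k) := fun k => ((hDm k).const_mul (w k)).const_mul t
  have hv'm : ∀ k, Measurable (v' k) := fun _ => measurable_const
  have hD'b : ∀ k ω, |D' k ω| ≤ t * (2 * βu + 2 * b) := fun k ω => by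
    simp only [hD']; rw [abs_mul, abs_of_pos ht0, abs_mul]
    refine mul_le_mul_of_nonneg_left ?_ ht0.le
    calc |w k| * |D k ω| ≤ 1 * (2 * βu + 2 * b) := mul_le_mul (hw k) (hDb k ω) (abs_nonneg _) zero_le_one
      _ = 2 * βu + 2 * b := one_mul _
  have hv'0 : ∀ (k : ℕ) (ω : Ω), 0 ≤ v' k ω := fun _ _ => by positivity
  have hv'b : ∀ (k : ℕ) (ω : Ω), v' k ω ≤ t ^ 2 * (b * σ2) := fun k _ => by
    simp only [hv']
    refine mul_le_mul_of_nonneg_left ?_ (sq_nonneg t)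
    calc w k ^ 2 * (b * σ2) ≤ 1 * (b * σ2) := mul_le_mul_of_nonneg_right (hw2 k) (by positivity)
      _ = b * σ2 := one_mul _
  have hmono : ∀ j k : ℕ, j ≤ k → (((j : ℝ) * b).toNNReal) ≤ (((k : ℝ) * b).toNNReal) := fun j k hjk =>
    Real.toNNReal_le_toNNReal (mul_le_mul_of_nonneg_right (by exact_mod_cast hjk) hb.le)
  have hSF : ∀ k : ℕ, Measurable[hW.natFiltration (((k : ℝ) * b).toNNReal)] fun ω => ∑ j ∈ Finset.range k, D' j ω := fun k =>
    Finset.measurable_sum _ fun j hj => by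
      have hle : ((((j + 1 : ℕ) : ℝ) * b).toNNReal) ≤ (((k : ℝ) * b).toNNReal) := hmono (j + 1) k (Nat.succ_le_of_lt (Finset.mem_range.1 hj))
      exact (((hDF j).mono (hW.natFiltration.mono hle) le_rfl).const_mul (w j)).const_mul t
  have hVF : ∀ k : ℕ, Measurable[hW.natFiltration (((k : ℝ) * b).toNNReal)] fun ω => ∑ j ∈ Finset.range k, v' j ω := fun k =>
    Finset.measurable_sum _ fun j _ => measurable_const
  have horth' : ∀ k < J, ∀ Z : Ω → ℝ, Measurable[hW.natFiltration (((k : ℝ) * b).toNNReal)] Z → (∀ ω, 0 ≤ Z ω) →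
      (∃ CZ : ℝ, ∀ ω, Z ω ≤ CZ) → ∫ ω, Z ω * D' k ω ∂P = 0 := fun k _ Z hZ hZ0 hZb => by
    have h1 := horth k Z hZ hZ0 hZb
    simp only [hD']
    rw [integral_congr_ae (ae_of_all _ fun ω => show Z ω * (t * (w k * D k ω)) = (t * w k) * (Z ω * D k ω) by ring), integral_const_mul, h1,
      mul_zero]
  have hvar'' : ∀ k < J, ∀ Z : Ω → ℝ, Measurable[hW.natFiltration (((k : ℝ) * b).toNNReal)] Z → (∀ ω, 0 ≤ Z ω) →
      (∃ CZ : ℝ, ∀ ω, Z ω ≤ CZ) → |∫ ω, Z ω * (D' k ω ^ 2 - v' k ω) ∂P| ≤ (t ^ 2 * ηb) * ∫ ω, Z ω ∂P := fun k _ Z hZ hZ0 hZb => by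
    have h1 := hvar' k Z hZ hZ0 hZb
    have hEZ0 : 0 ≤ ∫ ω, Z ω ∂P := integral_nonneg hZ0
    simp only [hD', hv']
    rw [integral_congr_ae (ae_of_all _ fun ω => show Z ω * ((t * (w k * D k ω)) ^ 2 - t ^ 2 * (w k ^ 2 * (b * σ2))) =
      (t ^ 2 * w k ^ 2) * (Z ω * (D k ω ^ 2 - b * σ2)) by ring), integral_const_mul, abs_mul, abs_of_nonneg (by positivity : (0:ℝ) ≤ t ^ 2 * w k ^ 2)]
    calc t ^ 2 * w k ^ 2 * |∫ ω, Z ω * (D k ω ^ 2 - b * σ2) ∂P| ≤ t ^ 2 * 1 * (ηb * ∫ ω, Z ω ∂P) :=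
          mul_le_mul (mul_le_mul_of_nonneg_left (hw2 k) (sq_nonneg t)) h1 (abs_nonneg _) (by positivity)
      _ = t ^ 2 * ηb * ∫ ω, Z ω ∂P := by ring
  have hE := norm_integral_cexp_sum_sub_gaussian_le (fun k : ℕ => hW.natFiltration (((k : ℝ) * b).toNNReal))
    (fun k => hW.natFiltration.le _) D' v' hD'm hv'm (by positivity : (0 : ℝ) ≤ t * (2 * βu + 2 * b))
    (by positivity : (0 : ℝ) ≤ t ^ 2 * (b * σ2)) (by positivity : (0 : ℝ) ≤ t ^ 2 * ηb) hD'b hv'0 hv'b hSF hVF J horth' hvar'' hs2_0 θ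
  -- `J t² b = 1`
  have hJt : (J : ℝ) * (t ^ 2 * b) = 1 := by
    rw [ht2, hT]; field_simp
  have hV : ∫ ω, |(∑ j ∈ Finset.range J, v' j ω) - s2| ∂P = 0 := by
    have h1 : ∀ ω, (∑ j ∈ Finset.range J, v' j ω) - s2 = 0 := fun ω => by
      simp only [hv', hs2]
      rw [← Finset.mul_sum, ← Finset.sum_mul]
      have : t ^ 2 * ((∑ i ∈ Finset.range J, w i ^ 2) * (b * σ2)) = (J * (t ^ 2 * b)) * (σ2 * (∑ i ∈ Finset.range J, w i ^ 2)) / J := by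
        field_simp
      rw [this, hJt, one_mul, sub_self]
    simp_rw [h1, abs_zero, integral_zero]
  have hJA : (J : ℝ) * (θ ^ 2 * (t ^ 2 * (b * σ2)) / 2) = θ ^ 2 * σ2 / 2 := by
    rw [show (J : ℝ) * (θ ^ 2 * (t ^ 2 * (b * σ2)) / 2) = (J * (t ^ 2 * b)) * (θ ^ 2 * σ2 / 2) by ring, hJt, one_mul]
  rw [hV, mul_zero, add_zero, hJA] at hE
  /- ### 3. Simplify `J · ρ'` -/
  set B : ℝ := t * (2 * βu + 2 * b) with hB
  set E : ℝ := ηb / b with hEdef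
  have hB_eq : (2 * βu + 2 * b) / Real.sqrt (J * b) = B := by rw [hB, ht, hT, div_eq_inv_mul]
  have hJρ : (J : ℝ) * Real.exp (θ ^ 2 * σ2 / 2) *
      (θ ^ 2 * (t ^ 2 * ηb) + |θ| ^ 3 * Real.exp (|θ| * (t * (2 * βu + 2 * b))) * (t * (2 * βu + 2 * b)) *
        (t ^ 2 * (b * σ2) + t ^ 2 * ηb) + (θ ^ 2 * (t ^ 2 * (b * σ2)) / 2) ^ 2 +
        (|θ| * (t * (2 * βu + 2 * b)) + θ ^ 2 * (t * (2 * βu + 2 * b)) ^ 2 / 2) * (θ ^ 2 * (t ^ 2 * (b * σ2)) / 2)) =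
      Real.exp (θ ^ 2 * σ2 / 2) * (θ ^ 2 * E + |θ| ^ 3 * Real.exp (|θ| * B) * B * (σ2 + E) + θ ^ 4 * σ2 ^ 2 / 4 * (J : ℝ)⁻¹ +
        (|θ| * B + θ ^ 2 * B ^ 2 / 2) * (θ ^ 2 * σ2 / 2)) := by
    have hJ0 : (J : ℝ) ≠ 0 := by positivity
    have hb0 : b ≠ 0 := hb.ne'
    -- `J t² = 1/b`
    have hJt' : (J : ℝ) * t ^ 2 = b⁻¹ := by
      have := hJt; field_simp; linarith [this]
    simp only [hB, hEdef]
    have e1 : (J : ℝ) * (θ ^ 2 * (t ^ 2 * ηb)) = θ ^ 2 * (ηb / b) := by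
      rw [show (J : ℝ) * (θ ^ 2 * (t ^ 2 * ηb)) = θ ^ 2 * ((J * t ^ 2) * ηb) by ring, hJt', div_eq_inv_mul]
    have e2 : (J : ℝ) * (t ^ 2 * (b * σ2) + t ^ 2 * ηb) = σ2 + ηb / b := by
      rw [show (J : ℝ) * (t ^ 2 * (b * σ2) + t ^ 2 * ηb) = (J * (t ^ 2 * b)) * σ2 + (J * t ^ 2) * ηb by ring, hJt, hJt', one_mul,
        div_eq_inv_mul]
    have e3 : (J : ℝ) * (θ ^ 2 * (t ^ 2 * (b * σ2)) / 2) ^ 2 = θ ^ 4 * σ2 ^ 2 / 4 * (J : ℝ)⁻¹ := by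
      have : (J : ℝ) * (θ ^ 2 * (t ^ 2 * (b * σ2)) / 2) ^ 2 = (J * (t ^ 2 * b)) ^ 2 * (θ ^ 4 * σ2 ^ 2 / 4) * (J : ℝ)⁻¹ := by
        field_simp; ring
      rw [this, hJt, one_pow, one_mul]
    have e4 : (J : ℝ) * (θ ^ 2 * (t ^ 2 * (b * σ2)) / 2) = θ ^ 2 * σ2 / 2 := hJA
    calc (J : ℝ) * Real.exp (θ ^ 2 * σ2 / 2) *
          (θ ^ 2 * (t ^ 2 * ηb) + |θ| ^ 3 * Real.exp (|θ| * (t * (2 * βu + 2 * b))) * (t * (2 * βu + 2 * b)) *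
            (t ^ 2 * (b * σ2) + t ^ 2 * ηb) + (θ ^ 2 * (t ^ 2 * (b * σ2)) / 2) ^ 2 +
            (|θ| * (t * (2 * βu + 2 * b)) + θ ^ 2 * (t * (2 * βu + 2 * b)) ^ 2 / 2) * (θ ^ 2 * (t ^ 2 * (b * σ2)) / 2))
        = Real.exp (θ ^ 2 * σ2 / 2) *
          ((J : ℝ) * (θ ^ 2 * (t ^ 2 * ηb)) + |θ| ^ 3 * Real.exp (|θ| * (t * (2 * βu + 2 * b))) * (t * (2 * βu + 2 * b)) *
            ((J : ℝ) * (t ^ 2 * (b * σ2) + t ^ 2 * ηb)) + (J : ℝ) * (θ ^ 2 * (t ^ 2 * (b * σ2)) / 2) ^ 2 +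
            (|θ| * (t * (2 * βu + 2 * b)) + θ ^ 2 * (t * (2 * βu + 2 * b)) ^ 2 / 2) * ((J : ℝ) * (θ ^ 2 * (t ^ 2 * (b * σ2)) / 2))) := by
          ring
      _ = Real.exp (θ ^ 2 * σ2 / 2) * (θ ^ 2 * (ηb / b) + |θ| ^ 3 * Real.exp (|θ| * (t * (2 * βu + 2 * b))) * (t * (2 * βu + 2 * b)) *
            (σ2 + ηb / b) + θ ^ 4 * σ2 ^ 2 / 4 * (J : ℝ)⁻¹ +
            (|θ| * (t * (2 * βu + 2 * b)) + θ ^ 2 * (t * (2 * βu + 2 * b)) ^ 2 / 2) * (θ ^ 2 * σ2 / 2)) := by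
          rw [e1, e2, e3, e4]
  rw [hJρ] at hE
  -- the statistic is `Σ D'`
  have hstat : ∀ ω, t * ∑ k ∈ Finset.range J, w k * D k ω = ∑ j ∈ Finset.range J, D' j ω := fun ω => by
    simp only [hD']; rw [Finset.mul_sum]
  have hgoal : (fun ω => Complex.exp (((θ * ((Real.sqrt (J * b))⁻¹ * ∑ k ∈ Finset.range J, w k * D k ω) : ℝ) : ℂ) * Complex.I)) =
      fun ω => Complex.exp (((θ * ∑ j ∈ Finset.range J, D' j ω : ℝ) : ℂ) * Complex.I) := by
    funext ω; rw [← hstat ω]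
  rw [hgoal, hB_eq]
  refine hE.trans (le_of_eq ?_)
  simp only [hEdef]

end Summit.QuantumFields.YangMills.Theorems.ColdStartUniversality

end
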